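import Summits.QuantumFields.YangMills.Theorems.LuscherReductionOneSiteLevelsGnPotential
import Summits.QuantumFields.YangMills.Theorems.LuscherReductionOneSiteLevelsPhase
import Literature.AlgebraicTopology.FundamentalGroup.RotationGroupSO3

/-!
# INNER, layer II (chart layer): physical functions at gnomonic chart points — pattern independence, `Ad : SU(2) → SO(3)` onto,
# colour-rotation invariance of the chart function, and the support radius of `cos Θ_B` in the chart

Support module of crux `OneSiteLevels` (route `LuscherReduction`, item stmt-QuantumFields-20007; STUB-PLAN
`Cruxes/OneSiteLevels/STUB-PLAN-stub_absUpperInnerAL1.md` §2.2 items II.1 and II.3, kill criterion K2), fleet seat ym-luscher-20007-p2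
(LATTICE lane).  Everything here is proved, AL1-free.

The monotone flattening (layer II) computes every one-site integral through the sign-pattern gnomonic chart
`configMeasure = Σ_σ (ρ_μ · Lebesgue) ∘ (gnChart μ σ)⁻¹` (`configMeasure_su2_one_eq_sum_gnChart`), so only the values of the integrands AT
CHART POINTS `gnChart μ σ y` matter.  This file supplies those values for a physical `ψ` and for the IMS phase `Θ = onePhase ℓ`:
* §1 `exists_adRot_eq`: every `R ∈ SO(3)` is `adRot V` for some `V ∈ SU(2)` (`adRot V = quatRot (su2Quat V)` and the Literature
  covering map `rotHom : S³ → SO(3)` is onto, `RotationGroupSO3.surjective_rotHom` [HatcherAT2002, §3.D]).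
* §2 `conj_gnoPoint`, `gnChart_colourRotate`: conjugating a chart configuration by `V` rotates its coordinate by `adRot V`.
* §3 `gnChart_eq_twist`, `IsPhys.apply_gnChart`, `onePhase_gnChart`: the eight patterns are related by centre twists, so a physical
  `ψ`, the phase `Θ` (and the Wilson action, `wilsonAction_gnChart`) take the SAME value on all eight chart points over `y`.
* §4 `chartFn μ ψ = ψ ∘ gnChart μ pos`: measurable, bounded, and COLOUR-ROTATION INVARIANT (`isGaugeInv_chartFn`) for physical `ψ` — the
  converse direction of `isPhys_gnPullback` (K2 of the STUB-PLAN: a physical zero-flux function at `L = 1` is a function of the gnomonic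
  coordinate); likewise `onePhase`, `gnPot` and the chart density are colour-rotation invariant functions of `y`.
* §5 `csq_le_of_cos_onePhase_gnChart_ne_zero`, `norm_le_of_cos_onePhase_gnChart_ne_zero`: on the support of `cos Θ_ℓ` every block has
  `μ²|y_i|²(1 − 2ℓ²) ≤ 2ℓ²`; with `ℓ² = t ≤ 1/4`, `μ = t/2`: `‖y‖ ≤ 7/√t` (II.1).

## WHAT THIS IS NOT
Not the INNER stub; no flat analysis here.  Femto rung R2b1 vocabulary; NOT an infinite-volume ∕ Clay gap statement.
-/

set_option autoImplicit false

noncomputable section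

open MeasureTheory Filter Topology Real
open scoped Matrix Quaternion
open Literature.MathematicalPhysics.QuantumFieldTheory
open Literature.MathematicalPhysics.QuantumLattice
open Literature.Analysis.OperatorTheory.YMMatrixModel
open Literature.MathematicalPhysics.QuantumFieldTheory.Balaban1983to89.T4CubeChartGnomonic (gnoPoint gnoWeight
  su2Quat_gnoPoint)
open Literature.AlgebraicTopology.FundamentalGroup (quatRot rotHom surjective_rotHom coe_rotHom)

namespace Summit.QuantumFields.YangMills.Theorems.FemtoTransferGap

/-! ### §1. `Ad : SU(2) → SO(3)` is onto -/

/-- The adjoint rotation is the rotation matrix of the unit quaternion of `V`: `adRot V = quatRot (su2Quat V)` (same quadratic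
parametrisation). [cite: HatcherAT2002, §3.D] -/
theorem adRot_eq_quatRot (V : SU2) : adRot V = quatRot (su2Quat V) := by
  ext i j
  fin_cases i <;> fin_cases j <;> simp [adRot, quatRot, su2Quat, add_comm]

/-- Two elements of `SU(2)` with the same unit quaternion coincide. [folklore] -/
theorem eq_of_su2Quat_eq {U W : SU2} (h : su2Quat U = su2Quat W) : U = W := by
  rw [← quatToSU2_su2Quat U, ← quatToSU2_su2Quat W, h]

/-- Two elements of `SU(2)` with the same scalar and vector parts coincide. [folklore] -/
theorem eq_of_scalarPart_eq_of_vecPart_eq {U W : SU2} (h0 : scalarPart U = scalarPart W) (hv : vecPart U = vecPart W) : U = W := by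
  apply eq_of_su2Quat_eq
  have h1 := congrFun hv 0
  have h2 := congrFun hv 1
  have h3 := congrFun hv 2
  simp only [vecPart, Matrix.cons_val_zero, Matrix.cons_val_one, Matrix.cons_val] at h1 h2 h3
  exact Quaternion.ext _ _ h0 h1 h2 h3

/-- **Every rotation of `ℝ³` is an adjoint rotation**: `R ∈ SO(3) ⇒ ∃ V ∈ SU(2), adRot V = R` (the covering map `S³ → SO(3)` is onto).
[cite: HatcherAT2002, §3.D] [cite: BrockerTomDieck1985, I (1.10)] -/
theorem exists_adRot_eq {R : Matrix (Fin 3) (Fin 3) ℝ} (hR : R ∈ Matrix.specialOrthogonalGroup (Fin 3) ℝ) :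
    ∃ V : SU2, adRot V = R := by
  obtain ⟨hO, hdet⟩ := Matrix.mem_specialOrthogonalGroup_iff.1 hR
  have h1 : Rᵀ * R = 1 := by
    have h := Matrix.mem_unitaryGroup_iff'.1 hO
    simpa [Matrix.star_eq_conjTranspose] using h
  obtain ⟨q, hq⟩ := surjective_rotHom ⟨R, h1, hdet⟩
  have hqR : quatRot (q : ℍ) = R := by
    have := congrArg Subtype.val hq
    simpa using this
  have hq1 : ‖(q : ℍ)‖ = 1 := norm_eq_of_mem_sphere q
  have hq0 : (q : ℍ) ≠ 0 := by
    intro h; rw [h, norm_zero] at hq1; exact zero_ne_one hq1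
  refine ⟨quatToSU2 (q : ℍ), ?_⟩
  rw [adRot_eq_quatRot,
    Literature.MathematicalPhysics.QuantumFieldTheory.Balaban1983to89.T4HaarSU2Translate.su2Quat_quatToSU2 hq0, hq1, inv_one,
    one_smul, hqR]

/-! ### §2. Conjugation of chart configurations = colour rotation of the coordinate -/

/-- `Σ_a v_a²` is invariant under adjoint rotations. [folklore] -/
theorem vsq_adRot_mulVec (V : SU2) (v : Fin 3 → ℝ) : vsq ((adRot V).mulVec v) = vsq v := by
  have hR := adRot_mem_specialOrthogonalGroup V
  unfold vsq
  simp only [Matrix.mulVec, dotProduct]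
  calc ∑ a, (∑ b, adRot V a b * v b) ^ 2
      = ∑ a, ∑ b, ∑ c, adRot V a b * adRot V a c * (v b * v c) := by
        refine Finset.sum_congr rfl fun a _ => ?_
        rw [sq, Finset.sum_mul_sum]
        exact Finset.sum_congr rfl fun b _ => Finset.sum_congr rfl fun c _ => by ring
    _ = ∑ b, ∑ c, (∑ a, adRot V a b * adRot V a c) * (v b * v c) := by
        rw [Finset.sum_comm]
        refine Finset.sum_congr rfl fun b _ => ?_
        rw [Finset.sum_comm]
        refine Finset.sum_congr rfl fun c _ => ?_
        rw [Finset.sum_mul]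
    _ = ∑ b, v b ^ 2 := by
        refine Finset.sum_congr rfl fun b _ => ?_
        simp_rw [sum_mul_eq_of_mem_SO hR]
        simp [sq]

/-- `‖(1, R v)‖ = ‖(1, v)‖` for an adjoint rotation `R = adRot V`. [folklore] -/
theorem norm_gnomonicQuat_adRot_mulVec (V : SU2) (v : Fin 3 → ℝ) :
    ‖gnomonicQuat ((adRot V).mulVec v)‖ = ‖gnomonicQuat v‖ := by
  have h1 := norm_gnomonicQuat_sq ((adRot V).mulVec v)
  have h2 := norm_gnomonicQuat_sq v
  rw [vsq_adRot_mulVec] at h1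
  exact (sq_eq_sq₀ (norm_nonneg _) (norm_nonneg _)).1 (by rw [h1, h2])

/-- **Conjugating a gnomonic point rotates its coordinate**: `V · P(1,v) · V⁻¹ = P(1, Ad(V) v)`. [cite: BrockerTomDieck1985, I (1.10)] -/
theorem conj_gnoPoint (V : SU2) (v : Fin 3 → ℝ) : V * gnoPoint v * V⁻¹ = gnoPoint ((adRot V).mulVec v) := by
  apply eq_of_scalarPart_eq_of_vecPart_eq
  · rw [scalarPart_conj, scalarPart_gnoPoint, scalarPart_gnoPoint, norm_gnomonicQuat_adRot_mulVec]
  · rw [vecPart_conj]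
    funext a
    rw [vecPart_gnoPoint, norm_gnomonicQuat_adRot_mulVec, Matrix.mulVec, dotProduct, Matrix.mulVec, dotProduct, Finset.mul_sum]
    refine Finset.sum_congr rfl fun b _ => ?_
    rw [vecPart_gnoPoint]; ring

/-- `hemi b` is central. [folklore] -/
theorem hemi_mem_center (b : Bool) : hemi b ∈ Subgroup.center SU2 := by
  rcases hemi_eq b with h | h
  · rw [h]; exact Subgroup.one_mem _
  · rw [h]; exact negOne_mem_center

/-- Coordinates of a colour rotation. [folklore] -/
theorem colourRotate_apply (R : Matrix (Fin 3) (Fin 3) ℝ) (x : ZM) (p : Fin 3 × Fin 3) :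
    colourRotate R x p = ∑ b : Fin 3, R p.2 b * x (p.1, b) := rfl

/-- The scaled block of a rotated coordinate is the rotated scaled block. [folklore] -/
theorem block_colourRotate (μ : ℝ) (R : Matrix (Fin 3) (Fin 3) ℝ) (y : ZM) (i : Fin 3) :
    (fun a => μ * colourRotate R y (i, a)) = R.mulVec (fun a => μ * y (i, a)) := by
  funext a
  rw [colourRotate_apply, Matrix.mulVec, dotProduct, Finset.mul_sum]
  exact Finset.sum_congr rfl fun b _ => by ring

/-- **The chart intertwines colour rotation and conjugation**: `gnChart μ σ (Ad(V)·y) = V · (gnChart μ σ y) · V⁻¹` linkwise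
(the hemisphere signs are central). [cite: Vanbaal2001, §4] -/
theorem gnChart_colourRotate (μ : ℝ) (σ : Fin 3 → Bool) (V : SU2) (y : ZM) :
    gnChart μ σ (colourRotate (adRot V) y) = fun e => V * gnChart μ σ y e * V⁻¹ := by
  funext e
  unfold gnChart
  rw [block_colourRotate, ← conj_gnoPoint]
  have hc : V * hemi (σ e.2) = hemi (σ e.2) * V := (Subgroup.mem_center_iff.1 (hemi_mem_center (σ e.2)) V)
  rw [← mul_assoc, ← mul_assoc, ← hc, mul_assoc V (hemi (σ e.2))]

/-- As a gauge transformation: `gnChart μ σ (Ad(V)·y) = gaugeTransform (fun _ => V) (gnChart μ σ y)`. [cite: Vanbaal2001, §4] -/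
theorem gnChart_colourRotate_eq_gaugeTransform (μ : ℝ) (σ : Fin 3 → Bool) (V : SU2) (y : ZM) :
    gnChart μ σ (colourRotate (adRot V) y) = gaugeTransform (fun _ : Site 3 1 => V) (gnChart μ σ y) := by
  rw [gnChart_colourRotate, gaugeTransform_one_site_eq]

/-! ### §3. The eight patterns differ by centre twists: pattern independence of physical data -/

/-- The all-upper-hemisphere pattern. [folklore] -/
def pos : Fin 3 → Bool := fun _ => false

/-- `hemi false = 1`. [folklore] -/
@[simp] theorem hemi_false : hemi false = 1 := rfl

/-- **A chart configuration of pattern `σ` is the triple centre twist of the positive-pattern one.** [folklore] -/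
theorem gnChart_eq_twist (μ : ℝ) (σ : Fin 3 → Bool) (y : ZM) :
    gnChart μ σ y = twist 0 (hemi (σ 0)) (twist 1 (hemi (σ 1)) (twist 2 (hemi (σ 2)) (gnChart μ pos y))) := by
  rw [twist_one_site, twist_one_site, twist_one_site]
  funext e
  obtain ⟨x, i⟩ := e
  unfold gnChart pos
  fin_cases i <;> simp

/-- **A physical function takes the same value on all eight chart points over `y`.** [cite: Luscher1983, §2] -/
theorem IsPhys.apply_gnChart {ψ : Cfg → ℝ} (hψ : IsPhys ψ) (μ : ℝ) (σ : Fin 3 → Bool) (y : ZM) :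
    ψ (gnChart μ σ y) = ψ (gnChart μ pos y) := by
  rw [gnChart_eq_twist, hψ.zeroFlux 0 _ (hemi_mem_center _), hψ.zeroFlux 1 _ (hemi_mem_center _),
    hψ.zeroFlux 2 _ (hemi_mem_center _)]

/-- The IMS phase takes the same value on all eight chart points over `y`. [folklore] -/
theorem onePhase_gnChart (ℓ μ : ℝ) (σ : Fin 3 → Bool) (y : ZM) :
    onePhase ℓ (gnChart μ σ y) = onePhase ℓ (gnChart μ pos y) := by
  rw [gnChart_eq_twist, onePhase_twist ℓ 0 (hemi_mem_center _), onePhase_twist ℓ 1 (hemi_mem_center _),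
    onePhase_twist ℓ 2 (hemi_mem_center _)]

/-! ### §4. The chart function of a physical test function -/

/-- **The chart function** of `ψ` at scale `μ`: `chartFn μ ψ y = ψ (gnChart μ pos y)`. [cite: Luscher1983, §2] -/
def chartFn (μ : ℝ) (ψ : Cfg → ℝ) (y : ZM) : ℝ := ψ (gnChart μ pos y)

/-- `ψ` at ANY chart point over `y` is the chart function (physical `ψ`). [cite: Luscher1983, §2] -/
theorem IsPhys.apply_gnChart_eq_chartFn {ψ : Cfg → ℝ} (hψ : IsPhys ψ) (μ : ℝ) (σ : Fin 3 → Bool) (y : ZM) :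
    ψ (gnChart μ σ y) = chartFn μ ψ y :=
  hψ.apply_gnChart μ σ y

/-- The chart function is measurable. [folklore] -/
theorem measurable_chartFn (μ : ℝ) {ψ : Cfg → ℝ} (hψ : Measurable ψ) : Measurable (chartFn μ ψ) :=
  hψ.comp (measurable_gnChart μ pos)

/-- The chart function is bounded by the same constant. [folklore] -/
theorem chartFn_bounded (μ : ℝ) {ψ : Cfg → ℝ} {C : ℝ} (hC : ∀ U, |ψ U| ≤ C) : ∀ y, |chartFn μ ψ y| ≤ C :=
  fun _ => hC _

/-- **The chart function of a physical `ψ` is colour-rotation invariant** (`SO(3) = Ad(SU(2))` and gauge invariance of `ψ`).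
[cite: Luscher1983, §2] [cite: Vanbaal2001, §4] -/
theorem isGaugeInv_chartFn (μ : ℝ) {ψ : Cfg → ℝ} (hψ : IsPhys ψ) : IsGaugeInv (chartFn μ ψ) := by
  intro R hR y
  obtain ⟨V, rfl⟩ := exists_adRot_eq hR
  show ψ (gnChart μ pos (colourRotate (adRot V) y)) = ψ (gnChart μ pos y)
  rw [gnChart_colourRotate_eq_gaugeTransform, hψ.gaugeInv]

/-- The IMS phase in the chart is colour-rotation invariant. [folklore] -/
theorem onePhase_gnChart_colourRotate (ℓ μ : ℝ) {R : Matrix (Fin 3) (Fin 3) ℝ} (hR : R ∈ Matrix.specialOrthogonalGroup (Fin 3) ℝ)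
    (y : ZM) : onePhase ℓ (gnChart μ pos (colourRotate R y)) = onePhase ℓ (gnChart μ pos y) := by
  obtain ⟨V, rfl⟩ := exists_adRot_eq hR
  rw [gnChart_colourRotate_eq_gaugeTransform, onePhase_gaugeTransform]

/-- The chart potential `gnPot μ` is colour-rotation invariant (it is `S/8` of the chart configuration). [folklore] -/
theorem gnPot_colourRotate (μ : ℝ) {R : Matrix (Fin 3) (Fin 3) ℝ} (hR : R ∈ Matrix.specialOrthogonalGroup (Fin 3) ℝ) (y : ZM) :
    gnPot μ (colourRotate R y) = gnPot μ y := by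
  obtain ⟨V, rfl⟩ := exists_adRot_eq hR
  have h1 := wilsonAction_gnChart μ pos (colourRotate (adRot V) y)
  have h2 := wilsonAction_gnChart μ pos y
  rw [gnChart_colourRotate_eq_gaugeTransform, wilsonAction_gaugeTransform] at h1
  linarith

/-- `|x_i|²` is colour-rotation invariant. [cite: Vanbaal2001, §4] -/
theorem csq_colourRotate {R : Matrix (Fin 3) (Fin 3) ℝ} (hR : R ∈ Matrix.specialOrthogonalGroup (Fin 3) ℝ) (x : ZM) (i : Fin 3) :
    csq i (colourRotate R x) = csq i x := by
  rw [csq_eq_sum, csq_eq_sum]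
  simp only [colourRotate_apply]
  calc ∑ a, (∑ b, R a b * x (i, b)) ^ 2
      = ∑ a, ∑ b, ∑ c, R a b * R a c * (x (i, b) * x (i, c)) := by
        refine Finset.sum_congr rfl fun a _ => ?_
        rw [sq, Finset.sum_mul_sum]
        exact Finset.sum_congr rfl fun b _ => Finset.sum_congr rfl fun c _ => by ring
    _ = ∑ b, ∑ c, (∑ a, R a b * R a c) * (x (i, b) * x (i, c)) := by
        rw [Finset.sum_comm]
        refine Finset.sum_congr rfl fun b _ => ?_
        rw [Finset.sum_comm]
        refine Finset.sum_congr rfl fun c _ => ?_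
        rw [Finset.sum_mul]
    _ = ∑ b, x (i, b) ^ 2 := by
        refine Finset.sum_congr rfl fun b _ => ?_
        simp_rw [sum_mul_eq_of_mem_SO hR]
        simp [sq]

/-- The chart weights `c_i` are colour-rotation invariant. [folklore] -/
theorem gnC_colourRotate (μ : ℝ) {R : Matrix (Fin 3) (Fin 3) ℝ} (hR : R ∈ Matrix.specialOrthogonalGroup (Fin 3) ℝ) (y : ZM)
    (i : Fin 3) : gnC μ (colourRotate R y) i = gnC μ y i := by
  rw [gnC, gnC, csq_colourRotate hR]

/-- The chart density is colour-rotation invariant. [folklore] -/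
theorem gnDensityReal_colourRotate (μ : ℝ) {R : Matrix (Fin 3) (Fin 3) ℝ} (hR : R ∈ Matrix.specialOrthogonalGroup (Fin 3) ℝ)
    (y : ZM) : gnDensityReal μ (colourRotate R y) = gnDensityReal μ y := by
  rw [gnDensityReal_eq, gnDensityReal_eq]
  simp_rw [gnC_colourRotate μ hR]

/-! ### §5. The support of `cos Θ_ℓ` in the chart (II.1) -/

/-- **Block bound on the support of `cos Θ_ℓ`**: if `cos (onePhase ℓ (gnChart μ σ y)) ≠ 0` (`ℓ > 0`) then every block satisfies
`μ²|y_i|² (1 − 2ℓ²) ≤ 2ℓ²` (each link is within `2ℓ` of `±1`, `vacDist_lt_of_cos_onePhase_ne_zero`, and `|u⃗|² ≤ vacDist²/2`). [folklore] -/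
theorem csq_le_of_cos_onePhase_gnChart_ne_zero {ℓ μ : ℝ} (hℓ : 0 < ℓ) {σ : Fin 3 → Bool} {y : ZM}
    (h : Real.cos (onePhase ℓ (gnChart μ σ y)) ≠ 0) (i : Fin 3) :
    μ ^ 2 * csq i y * (1 - 2 * ℓ ^ 2) ≤ 2 * ℓ ^ 2 := by
  have hd := vacDist_lt_of_cos_onePhase_ne_zero hℓ h (edgeOf i)
  set W : SU2 := gnChart μ σ y (edgeOf i) with hW
  have hv : ∑ a, vecPart W a ^ 2 = μ ^ 2 * csq i y / (1 + μ ^ 2 * csq i y) := by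
    have e1 : ∀ a, vecPart W a ^ 2 = (‖gnomonicQuat (fun b => μ * y (i, b))‖⁻¹ * (μ * y (i, a))) ^ 2 := fun a => by
      rw [hW, vecPart_gnChart_sq]; rfl
    simp_rw [e1, mul_pow]
    rw [← Finset.mul_sum, inv_pow, norm_gnomonicQuat_sq, vsq_block, ← Finset.mul_sum, ← csq_eq_sum, div_eq_inv_mul]
  have h1 := sum_vecPart_sq_le_vacDist_sq W
  have h2 : vacDist W ^ 2 < (2 * ℓ) ^ 2 := by
    have := vacDist_nonneg W
    nlinarith
  rw [hv] at h1
  have hs : 0 ≤ μ ^ 2 * csq i y := by have := csq_nonneg i y; positivity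
  rw [div_le_iff₀ (by linarith)] at h1
  nlinarith

/-- **II.1 — the support radius of `cos Θ_B` in the chart at scale `μ = t/2`, `ℓ² = t ≤ 1/4`**: `‖y‖ ≤ 7/√t`
(`μ²|y_i|² ≤ 4ℓ² = 4t` per block, so `‖y‖² ≤ 48/t`). [folklore] -/
theorem norm_le_of_cos_onePhase_gnChart_ne_zero {t ℓ : ℝ} (ht : 0 < t) (ht4 : t ≤ 1 / 4) (hℓ : 0 < ℓ) (hℓt : ℓ ^ 2 = t)
    {σ : Fin 3 → Bool} {y : ZM} (h : Real.cos (onePhase ℓ (gnChart (t / 2) σ y)) ≠ 0) :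
    ‖y‖ ≤ 7 / Real.sqrt t := by
  have hb : ∀ i, csq i y ≤ 16 / t := by
    intro i
    have h1 := csq_le_of_cos_onePhase_gnChart_ne_zero (μ := t / 2) hℓ h i
    rw [hℓt] at h1
    have hc := csq_nonneg i y
    have h2 : t * (csq i y * t * (1 - 2 * t)) ≤ t * 8 := by linarith
    have h3 : csq i y * t * (1 - 2 * t) ≤ 8 := le_of_mul_le_mul_left h2 ht
    have h4 : csq i y * t * (1 / 2) ≤ csq i y * t * (1 - 2 * t) :=
      mul_le_mul_of_nonneg_left (by linarith) (mul_nonneg hc ht.le)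
    rw [le_div_iff₀ ht]
    linarith
  have hn : ‖y‖ ^ 2 ≤ 48 / t := by
    rw [norm_sq_eq_sum_csq]
    calc ∑ i, csq i y ≤ ∑ _i : Fin 3, 16 / t := Finset.sum_le_sum fun i _ => hb i
      _ = 48 / t := by simp; ring
  have hs : 0 < Real.sqrt t := Real.sqrt_pos.2 ht
  have hst : Real.sqrt t ^ 2 = t := Real.sq_sqrt ht.le
  rw [le_div_iff₀ hs]
  have h0 : 0 ≤ ‖y‖ * Real.sqrt t := by positivity
  have h49 : (‖y‖ * Real.sqrt t) ^ 2 ≤ 49 := by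
    rw [mul_pow, hst]
    calc ‖y‖ ^ 2 * t ≤ 48 / t * t := mul_le_mul_of_nonneg_right hn ht.le
      _ = 48 := by field_simp
      _ ≤ 49 := by norm_num
  nlinarith

end Summit.QuantumFields.YangMills.Theorems.FemtoTransferGap

end
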